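import Summits.QuantumFields.BalabanUV.Beta.D1BFx.RestConv

/-!
# `BalabanUV.Beta.D1BFx.CornerSummable` — road «BF-x» for binder row D1: THE CORNER'S TWO WEIGHTED SUMMABILITIES FROM THE PROFILE'S EXPONENTIAL BOUND
# (`|g v| ≤ C e^{−δ|v|₁}`, `δ > 0` ⇒ `w ↦ w_μw_ν·bfKernel g N u_μ u_ν w` and `w ↦ w_ν·bfKernel g N u_μ u_ν w` summable) — hence the (CONV) slot for EVERY
# `RestIdx` word from the road END's OWN hypotheses: the `hKr` family of `RoadEndBFx.d1Drift_BFx` (p222356) is DERIVABLE and can be dropped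

HONEST DEPENDENCY (page 1, mandatory): continuum YM on T⁴ ⇐ BetaPertH ∧ nine spine estimates (0/9 proved); BetaPertH ⇐ (D1) ∧ (D4) ∧
CAP+tail; G-an2-4 gates asym, D1 and NE2/3/4.  HONEST FRAMING (cell contract, verbatim): «discharging `BetaPertH` makes Bałaban's UV
stability UNCONDITIONAL — a real constructive-QFT result; it is NOT the continuum limit and NOT the Clay problem.»  THIS MODULE DISCHARGES
NOTHING of the wall: [folklore] estimates of a FINITE polynomial in shifted values of an exponentially bounded function (an3's `SpinTable.bfKernel` =
`8N²·D(g²) − 4N²·cellForm g`, read as `8N²(d² − c² − b² + a²) − 4N²(ad − bc)` in the four corner values), an2's `DecimatedMomentSummable.absMoment₂_of_decay510`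
∕ `summable_smul_of_absMoment₂`, and my `RestConv` BY NAME.  No `def`, no `Prop` minted, nothing cited, 0 sorry.  0 wall binders; NOT a (REST) bound, NOT
the (K) slot, NOT D1, NOT `BetaPertH`, NOT continuum, NOT Clay.

ABSOLUTE RULE (cell charter, verbatim): «No internally-minted statement may enter as a cited fact. Every hypothesis is either kernel-proved in
this package or a verbatim quotation of a PUBLISHED theorem with page reference. The manuscript(s) under audit are NOT citable for their own
disputed steps — they are the thing under adjudication; programme-internal (2001/route/tribunal) claims are never citable.»

WHY (my XREAD note on the owner's `CornerRest` p221226, journal l.15958; `RestConv` p223080).  `CornerRest.rest_corner_bound` and `RestConv.conv_restK` take the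
summabilities `h2 : Summable (w ↦ w_μw_ν·bfKernel g N u_μ u_ν w)`, `h1 : Summable (w ↦ w_ν·bfKernel g N u_μ u_ν w)` as displayed inputs.  At a fixed block size
the road END already displays an exponential bound `|gp n b v| ≤ C e^{−δ′|v|₁}`, `δ′ > 0`, on every frozen profile (`RoadEndBFx.d1Drift_BFx`'s `hg`); `bfKernel`
is a polynomial of degree 2 in the four values `g v, g (v+u_μ), g (v+u_ν), g (v+u_ν+u_μ)`, so it is a (5.10)-kernel `|bfKernel g N u_μ u_ν v| ≤ 40N²K²·e^{−δ|v|₁}`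
(`K = C·e^{δ(|u_μ|₁+|u_ν|₁)}`) and an2's absolute-moment summability gives `h2`, `h1`.  Consequently the whole (CONV) family `hKr` of the road END follows
from its other hypotheses (`ha`, `hGa`, `hg`, `hδW`, `hE…hQ`, `hμν`) — `hKr_roadEnd` below has LITERALLY `d1Drift_BFx`'s `hKr` shape.
* §1 `expBound_nonneg`, `abs_shift_le`, `abs_le_of_expBound`; §2 `bfKernel_eq_corner_poly`, **`decay510_bfKernel`**;
* §3 **`summable_weight₂_bfKernel`** (= `h2`), **`summable_weight₁_bfKernel`** (= `h1`);
* §4 **`conv_restK'`** ∕ **`hKr_restK'`** (my `RestConv` with `h2`∕`h1` discharged), **`hKr_roadEnd`** (the `hKr` hypothesis of `RoadEndBFx.d1Drift_BFx`, ∀ n ≥ 2, from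
  that theorem's own `ha hGa hg hδW hE hJ hΛ hR hQ hμν`).
Unit `b2b-balaban-beta-d1-formalise-leaf-03` (gen 4), D1 formalisation swarm; `LEAVES-BFx.md` rows A7 ∕ (CONV) (sub-leaf «D1-BFx-CORNER-SUMMABLE»).
-/

noncomputable section

namespace Summit.QuantumFields.BalabanUV.Beta.D1BFx.CornerSummable

open Finset Filter Topology
open scoped BigOperators
open Literature.MathematicalPhysics.QuantumFieldTheory.Balaban1983to89
open Literature.MathematicalPhysics.QuantumFieldTheory.Balaban1983to89.Beta
open B12Sec2to5 (l1 l1_nonneg Decay510)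
open ExpKernelCalculus (Site MKer BiLoc l1_sub_triangle)
open DyadicShell (Pt toReal toReal_apply)
open BubbleTransfer (unitVec)
open SpinTable (bfKernel)
open GhostTable (mixedDiffFun cellForm fwdDiffFun)
open WindowIdentification (psum)
open DecimatedMomentSummable (AbsMoment₂ IsMoment₂ absMoment₂_of_decay510 summable_smul_of_absMoment₂)
open DecimatedMomentLimit (l1_add_le)
open DressedMomentNormalisation (resSite)
open Summit.QuantumFields.BalabanUV.Beta.TameKernelCalculus (Spr)
open Summit.QuantumFields.BalabanUV.Beta.D1BFx.GluonLeg (Ga)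
open Summit.QuantumFields.BalabanUV.Beta.D1BFx.ReducedKernel (TableR)
open Summit.QuantumFields.BalabanUV.Beta.D1BFx.SplitInstance (RestIdx restK)
open Summit.QuantumFields.BalabanUV.Beta.D1BFx.RestConv (conv_restK)
open Summit.QuantumFields.BalabanUV.Beta.D1BFx.CrossERest (l1_neg')

/-! ## §1 Shifted values of an exponentially bounded function -/

section Shift

variable {g : Pt → ℝ} {C δ : ℝ}

/-- [folklore] The constant of an exponential bound is nonnegative. -/
theorem expBound_nonneg (hg : ∀ v, |g v| ≤ C * Real.exp (-δ * l1 v)) : 0 ≤ C := by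
  have h := hg 0
  have h1 : Real.exp (-δ * l1 (0 : Pt)) = 1 := by simp [l1]
  rw [h1, mul_one] at h
  exact (abs_nonneg _).trans h

/-- [folklore] A shifted value: `|g (v + a)| ≤ C·e^{δ|a|₁}·e^{−δ|v|₁}` (`δ ≥ 0`). -/
theorem abs_shift_le (hδ : 0 ≤ δ) (hg : ∀ v, |g v| ≤ C * Real.exp (-δ * l1 v)) (v a : Pt) :
    |g (v + a)| ≤ C * Real.exp (δ * l1 a) * Real.exp (-δ * l1 v) := by
  refine (hg (v + a)).trans ?_
  rw [mul_assoc, ← Real.exp_add]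
  refine mul_le_mul_of_nonneg_left (Real.exp_le_exp.mpr ?_) (expBound_nonneg hg)
  have ht : l1 (v - 0) ≤ l1 (v - (v + a)) + l1 (v + a - 0) := l1_sub_triangle v (v + a) 0
  rw [sub_zero, sub_zero, show v - (v + a) = -a by abel, l1_neg'] at ht
  nlinarith

/-- [folklore] The global bound: `|g u| ≤ C` (`δ ≥ 0`). -/
theorem abs_le_of_expBound (hδ : 0 ≤ δ) (hg : ∀ v, |g v| ≤ C * Real.exp (-δ * l1 v)) (u : Pt) : |g u| ≤ C := by
  refine (hg u).trans ?_
  have : Real.exp (-δ * l1 u) ≤ 1 := Real.exp_le_one_iff.mpr (by nlinarith [l1_nonneg u])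
  nlinarith [expBound_nonneg hg]

end Shift

/-! ## §2 `bfKernel` is a (5.10)-kernel -/

section Kernel

variable {g : Pt → ℝ} {C δ : ℝ}

/-- [folklore] an3's background-field kernel in the four corner values `a = g v`, `b = g (v+e)`, `c = g (v+e′)`, `d = g (v+e′+e)`:
`bfKernel g N e e′ v = 8N²(d² − c² − b² + a²) − 4N²(ad − bc)` (the cell form's cross terms cancel). -/
theorem bfKernel_eq_corner_poly (g : Pt → ℝ) (N : ℝ) (e e' v : Pt) :
    bfKernel g N e e' v = 8 * N ^ 2 * (g (v + e' + e) ^ 2 - g (v + e') ^ 2 - g (v + e) ^ 2 + g v ^ 2)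
      - 4 * N ^ 2 * (g v * g (v + e' + e) - g (v + e) * g (v + e')) := by
  simp only [bfKernel, mixedDiffFun, cellForm, fwdDiffFun]
  ring

/-- [folklore] **`bfKernel` THROUGH AN EXPONENTIALLY BOUNDED PROFILE IS A (5.10)-KERNEL**: `|g v| ≤ C e^{−δ|v|₁}`, `δ ≥ 0` ⟹
`|bfKernel g N u_μ u_ν v| ≤ 40·N²·K²·e^{−δ|v|₁}` with `K = C·e^{δ(|u_μ|₁ + |u_ν|₁)}`. -/
theorem decay510_bfKernel (hδ : 0 ≤ δ) (hg : ∀ v, |g v| ≤ C * Real.exp (-δ * l1 v)) (N : ℝ) (μ ν : Fin 4) :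
    Decay510 (bfKernel g N (unitVec μ) (unitVec ν))
      (40 * N ^ 2 * (C * Real.exp (δ * (l1 (unitVec μ : Pt) + l1 (unitVec ν : Pt)))) ^ 2) δ := by
  intro v
  set e : Pt := unitVec μ with he
  set e' : Pt := unitVec ν with he'
  set K : ℝ := C * Real.exp (δ * (l1 e + l1 e')) with hK
  set E : ℝ := Real.exp (-δ * l1 v) with hE
  have hC : 0 ≤ C := expBound_nonneg hg
  have hE0 : 0 ≤ E := (Real.exp_pos _).le
  have hCK : C ≤ K := by
    have : 1 ≤ Real.exp (δ * (l1 e + l1 e')) := Real.one_le_exp (by nlinarith [l1_nonneg e, l1_nonneg e'])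
    nlinarith
  have hK0 : 0 ≤ K := hC.trans hCK
  -- the four corner values: `≤ K·E` and `≤ K`
  have hshift : ∀ a : Pt, l1 a ≤ l1 e + l1 e' → |g (v + a)| ≤ K * E := by
    intro a ha
    refine (abs_shift_le hδ hg v a).trans (mul_le_mul_of_nonneg_right ?_ hE0)
    exact mul_le_mul_of_nonneg_left (Real.exp_le_exp.mpr (by nlinarith)) hC
  have h0 : |g v| ≤ K * E := by
    have h := hshift 0 (by simp only [l1]; simp; positivity)
    rwa [add_zero] at h
  have h1 : |g (v + e)| ≤ K * E := hshift e (by linarith [l1_nonneg e'])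
  have h2 : |g (v + e')| ≤ K * E := hshift e' (by linarith [l1_nonneg e])
  have h3 : |g (v + e' + e)| ≤ K * E := by
    have h := hshift (e' + e) ((l1_add_le e' e).trans (by linarith))
    rwa [← add_assoc] at h
  have g0 : |g v| ≤ K := (abs_le_of_expBound hδ hg _).trans hCK
  have g1 : |g (v + e)| ≤ K := (abs_le_of_expBound hδ hg _).trans hCK
  have g2 : |g (v + e')| ≤ K := (abs_le_of_expBound hδ hg _).trans hCK
  have g3 : |g (v + e' + e)| ≤ K := (abs_le_of_expBound hδ hg _).trans hCK
  -- squares and the two products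
  have sq_le : ∀ x : ℝ, |x| ≤ K * E → |x| ≤ K → x ^ 2 ≤ K ^ 2 * E := fun x hx hx' => by
    calc x ^ 2 = |x| * |x| := by rw [← sq_abs]; ring
      _ ≤ (K * E) * K := mul_le_mul hx hx' (abs_nonneg _) (by positivity)
      _ = K ^ 2 * E := by ring
  have prod_le : ∀ x y : ℝ, |x| ≤ K * E → |y| ≤ K → |x * y| ≤ K ^ 2 * E := fun x y hx hy => by
    rw [abs_mul]
    calc |x| * |y| ≤ (K * E) * K := mul_le_mul hx hy (abs_nonneg _) (by positivity)
      _ = K ^ 2 * E := by ring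
  have sa := sq_le _ h0 g0
  have sb := sq_le _ h1 g1
  have sc := sq_le _ h2 g2
  have sd := sq_le _ h3 g3
  have pad := prod_le _ _ h0 g3
  have pbc := prod_le _ _ h1 g2
  rw [bfKernel_eq_corner_poly]
  have hN : 0 ≤ N ^ 2 := sq_nonneg N
  calc |8 * N ^ 2 * (g (v + e' + e) ^ 2 - g (v + e') ^ 2 - g (v + e) ^ 2 + g v ^ 2)
        - 4 * N ^ 2 * (g v * g (v + e' + e) - g (v + e) * g (v + e'))|
      ≤ |8 * N ^ 2 * (g (v + e' + e) ^ 2 - g (v + e') ^ 2 - g (v + e) ^ 2 + g v ^ 2)|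
        + |4 * N ^ 2 * (g v * g (v + e' + e) - g (v + e) * g (v + e'))| := abs_sub _ _
    _ ≤ 8 * N ^ 2 * (g (v + e' + e) ^ 2 + g (v + e') ^ 2 + g (v + e) ^ 2 + g v ^ 2)
        + 4 * N ^ 2 * (|g v * g (v + e' + e)| + |g (v + e) * g (v + e')|) := by
        rw [abs_mul (8 * N ^ 2), abs_mul (4 * N ^ 2), abs_of_nonneg (by positivity : (0 : ℝ) ≤ 8 * N ^ 2),
          abs_of_nonneg (by positivity : (0 : ℝ) ≤ 4 * N ^ 2)]
        refine add_le_add (mul_le_mul_of_nonneg_left (abs_le.mpr ⟨?_, ?_⟩) (by positivity))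
          (mul_le_mul_of_nonneg_left (abs_sub _ _) (by positivity))
        · nlinarith [sq_nonneg (g (v + e' + e)), sq_nonneg (g (v + e')), sq_nonneg (g (v + e)), sq_nonneg (g v)]
        · nlinarith [sq_nonneg (g (v + e' + e)), sq_nonneg (g (v + e')), sq_nonneg (g (v + e)), sq_nonneg (g v)]
    _ ≤ 8 * N ^ 2 * (4 * (K ^ 2 * E)) + 4 * N ^ 2 * (2 * (K ^ 2 * E)) :=
        add_le_add (mul_le_mul_of_nonneg_left (by linarith) (by positivity)) (mul_le_mul_of_nonneg_left (by linarith) (by positivity))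
    _ = 40 * N ^ 2 * K ^ 2 * E := by ring
    _ = 40 * N ^ 2 * (C * Real.exp (δ * (l1 (unitVec μ : Pt) + l1 (unitVec ν : Pt)))) ^ 2 * Real.exp (-δ * l1 v) := by
        rw [hK, hE]

end Kernel

/-! ## §3 The corner's two weighted summabilities -/

section Summable

variable {g : Pt → ℝ} {C δ : ℝ}

/-- [folklore] An exponentially bounded profile (`δ > 0`) has an absolutely second-moment summable `bfKernel`. -/
theorem absMoment₂_bfKernel (hδ : 0 < δ) (hg : ∀ v, |g v| ≤ C * Real.exp (-δ * l1 v)) (N : ℝ) (μ ν : Fin 4) :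
    AbsMoment₂ (bfKernel g N (unitVec μ) (unitVec ν)) :=
  absMoment₂_of_decay510 hδ (decay510_bfKernel hδ.le hg N μ ν)

/-- [folklore] **`h2` OF `CornerRest` ∕ `RestConv` FROM THE PROFILE'S EXPONENTIAL BOUND**: `Summable (w ↦ w_κ·w_λ·bfKernel g N u_μ u_ν w)`. -/
theorem summable_weight₂_bfKernel (hδ : 0 < δ) (hg : ∀ v, |g v| ≤ C * Real.exp (-δ * l1 v)) (N : ℝ) (μ ν κ lam : Fin 4) :
    Summable fun w : Pt => (w κ : ℝ) * (w lam : ℝ) * bfKernel g N (unitVec μ) (unitVec ν) w := by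
  refine (summable_smul_of_absMoment₂ (absMoment₂_bfKernel hδ hg N μ ν) (IsMoment₂.coord2 κ lam)).congr fun w => ?_
  simp only [zsmul_eq_mul, Int.cast_mul]

/-- [folklore] **`h1` OF `CornerRest` ∕ `RestConv` FROM THE PROFILE'S EXPONENTIAL BOUND**: `Summable (w ↦ w_κ·bfKernel g N u_μ u_ν w)`. -/
theorem summable_weight₁_bfKernel (hδ : 0 < δ) (hg : ∀ v, |g v| ≤ C * Real.exp (-δ * l1 v)) (N : ℝ) (μ ν κ : Fin 4) :
    Summable fun w : Pt => (w κ : ℝ) * bfKernel g N (unitVec μ) (unitVec ν) w := by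
  refine (summable_smul_of_absMoment₂ (absMoment₂_bfKernel hδ hg N μ ν) (IsMoment₂.coord κ)).congr fun w => ?_
  simp only [zsmul_eq_mul]

end Summable

/-! ## §4 (CONV) for every REST word from the road END's own hypotheses -/

section Conv

variable (n : ℕ) [NeZero n] (a : ℝ) {g : Pt → ℝ} (cE cΛ cR cK cQ cE₂ cJ4 cΛ₂ cR₂ cQ₂ x₀ : ℝ) {WE WJ WΛ WR WQ : TableR}
  (ωgl ωgh lam N : ℝ) {μ ν : Fin 4} (b : Pt) {C δ CE CJ CΛt CRt CQ δW : ℝ}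

/-- [folklore] **(CONV) FOR EVERY REST WORD AT FIXED `(n, b)`, `h2`∕`h1` DISCHARGED** (`RestConv.conv_restK` + §3). -/
theorem conv_restK' (ha : 0 < a) (hGa : Spr (Ga n a)) (hδ : 0 < δ) (hg : ∀ v, |g v| ≤ C * Real.exp (-δ * l1 v)) (hδW : 0 < δW)
    (hE : ∀ κ u l u', BiLoc (WE κ u l u') u u' CE δW) (hJ : ∀ κ u l u', BiLoc (WJ κ u l u') u u' CJ δW)
    (hΛ : ∀ κ u l u', BiLoc (WΛ κ u l u') u u' CΛt δW) (hR : ∀ κ u l u', BiLoc (WR κ u l u') u u' CRt δW)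
    (hQ : ∀ κ u l u', BiLoc (WQ κ u l u') u u' CQ δW) (hμν : μ ≠ ν) (τ : RestIdx) :
    ∃ B, Tendsto (psum (restK n a g cE cΛ cR cK cQ cE₂ cJ4 cΛ₂ cR₂ cQ₂ x₀ WE WJ WΛ WR WQ ωgl ωgh lam N μ ν b τ)) atTop (𝓝 B) :=
  conv_restK n a cE cΛ cR cK cQ cE₂ cJ4 cΛ₂ cR₂ cQ₂ x₀ ωgl ωgh lam N b ha hGa hδ hg hδW hE hJ hΛ hR hQ hμν
    (summable_weight₂_bfKernel hδ hg N μ ν μ ν) (summable_weight₁_bfKernel hδ hg N μ ν ν) τ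

/-- [folklore] **THE OWNER'S `hKr` AT FIXED `n`, ALL WORDS, FROM `AssemblyEnd.defect_le_at`'s OWN HYPOTHESES** (site-dependent profile `gp b`). -/
theorem hKr_restK' {gp : Pt → Pt → ℝ} (ha : 0 < a) (hGa : Spr (Ga n a))
    (hg : ∀ b : Pt, ∃ C δ : ℝ, 0 < δ ∧ ∀ v, |gp b v| ≤ C * Real.exp (-δ * l1 v)) (hδW : 0 < δW)
    (hE : ∀ κ u l u', BiLoc (WE κ u l u') u u' CE δW) (hJ : ∀ κ u l u', BiLoc (WJ κ u l u') u u' CJ δW)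
    (hΛ : ∀ κ u l u', BiLoc (WΛ κ u l u') u u' CΛt δW) (hR : ∀ κ u l u', BiLoc (WR κ u l u') u u' CRt δW)
    (hQ : ∀ κ u l u', BiLoc (WQ κ u l u') u u' CQ δW) (hμν : μ ≠ ν) :
    ∀ τ : RestIdx, ∀ b ∈ (univ : Finset (Fin 4 → Fin n)).image resSite, ∃ B, Tendsto (psum (fun w : Pt =>
      restK n a (gp b) cE cΛ cR cK cQ cE₂ cJ4 cΛ₂ cR₂ cQ₂ x₀ WE WJ WΛ WR WQ ωgl ωgh lam N μ ν b τ w)) atTop (𝓝 B) := by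
  intro τ b _
  obtain ⟨C, δ, hδ, hgb⟩ := hg b
  exact conv_restK' n a cE cΛ cR cK cQ cE₂ cJ4 cΛ₂ cR₂ cQ₂ x₀ ωgl ωgh lam N b ha hGa hδ hgb hδW hE hJ hΛ hR hQ hμν τ

end Conv

section RoadEnd

variable {a : ℝ} {gp : ℕ → Pt → Pt → ℝ} {cE cVH cΛ cR cK cQ cE₂ cJ4 cΛ₂ cR₂ cQ₂ x₀ ωgl ωgh lam : ℕ → ℝ} {WE WJ WΛ WR WQ : ℕ → TableR}
  {N : ℝ} {μ ν : Fin 4} {CE CJ CΛt CRt CQ δW : ℕ → ℝ}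

/-- [folklore] **THE `hKr` HYPOTHESIS OF THE ROAD END `RoadEndBFx.d1Drift_BFx` (p222356) IN ITS OWN SHAPE, FROM THAT THEOREM'S OTHER HYPOTHESES**
(`ha`, `hGa`, `hg`, `hδW`, `hE hJ hΛ hR hQ`, `hμν`) — so it can be DROPPED from the END's displayed list. -/
theorem hKr_roadEnd (ha : 0 < a) (hGa : ∀ n : ℕ, 2 ≤ n → ∀ [NeZero n], Spr (Ga n a))
    (hg : ∀ n : ℕ, 2 ≤ n → ∀ b : Pt, ∃ C δ' : ℝ, 0 < δ' ∧ ∀ v, |gp n b v| ≤ C * Real.exp (-δ' * l1 v)) (hδW : ∀ n, 0 < δW n)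
    (hE : ∀ n κ u l u', BiLoc (WE n κ u l u') u u' (CE n) (δW n)) (hJ : ∀ n κ u l u', BiLoc (WJ n κ u l u') u u' (CJ n) (δW n))
    (hΛ : ∀ n κ u l u', BiLoc (WΛ n κ u l u') u u' (CΛt n) (δW n)) (hR : ∀ n κ u l u', BiLoc (WR n κ u l u') u u' (CRt n) (δW n))
    (hQ : ∀ n κ u l u', BiLoc (WQ n κ u l u') u u' (CQ n) (δW n)) (hμν : μ ≠ ν) :
    ∀ n : ℕ, 2 ≤ n → ∀ [NeZero n], ∀ τ : RestIdx, ∀ b ∈ (univ : Finset (Fin 4 → Fin n)).image resSite, ∃ B,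
      Tendsto (psum (fun w : Pt => restK n a (gp n b) (cE n) (cΛ n) (cR n) (cK n) (cQ n) (cE₂ n) (cJ4 n) (cΛ₂ n) (cR₂ n) (cQ₂ n) (x₀ n)
        (WE n) (WJ n) (WΛ n) (WR n) (WQ n) (ωgl n) (ωgh n) (lam n) N μ ν b τ w)) atTop (𝓝 B) := by
  intro n hn _ τ b hb
  exact hKr_restK' n a (cE n) (cΛ n) (cR n) (cK n) (cQ n) (cE₂ n) (cJ4 n) (cΛ₂ n) (cR₂ n) (cQ₂ n) (x₀ n) (ωgl n) (ωgh n) (lam n) N ha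
    (hGa n hn) (hg n hn) (hδW n) (hE n) (hJ n) (hΛ n) (hR n) (hQ n) hμν τ b hb

end RoadEnd

end Summit.QuantumFields.BalabanUV.Beta.D1BFx.CornerSummable

end
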